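import Summits.NavierStokesRegularity.NavierStokesRegularity.Theorems.SymmetricScarExists.Negative.SpiralWorld

/-!
# `SymmetricScarExists` (crux stmt-NavierStokesRegularity-11718, route RellichScar): the abstract
# one-slice SELECTION skeleton is false — negative-side support, part 8 (cdisprove seat, gen 3)

The route's foreseen layer-2 split of the crux is `ScarMapContinuous → OneSliceSelection →
SymmetricScarExists`, where `OneSliceSelection` is "a fixed or `SO(2)`-invariant point of the
(log-radial) shift on the compact scar set".  Stripped of the fluid mechanics, the selection step has
the shape

> a non-empty compact Hausdorff space carrying a continuous `ℝ`-flow `φ` (the zoom / log-radial shift)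
> and a commuting continuous circle action `ρ` (the rotations about `e₃`) contains a point fixed by the
> flow (homogeneous scar) or by the circle (axisymmetric scar)

(`OneSliceSelectionSkeleton` below).  This is FALSE (`not_oneSliceSelectionSkeleton`): on the circle
`ℝ/ℤ` let both `φ` and `ρ` act by translation — a minimal flow commuting with a free circle action, no
fixed point of either.  (Gen 1 of this seat refuted a discrete `Bool × Bool` version in evidence; this is
the continuous-group version matching the route's wording, landed so that it can be imported.)  In the
crux's own terms the counterexample is the shape of a `λ`-DSS or rotated-self-similar apex profile whose
scar orbit is a circle (cf. part 1 `SpiralWorld`, part 3 `SpiralField`): compactness of the apex class,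
continuity of the scar map and the two commuting symmetries alone select nothing; an engine for the crux
needs an input that breaks minimality (a monotone / variational quantity for the zoom flow — none is
known for Navier–Stokes, Albritton–Barker 2019 §1 — or a rigidity theorem excluding circle orbits, i.e.
the Type-I (R)DSS Liouville wall).

## References

* H. Furstenberg, *Recurrence in ergodic theory and combinatorial number theory* (1981), Ch. 1
  (minimal systems without fixed points). [Furstenberg1981]
* D. Albritton, T. Barker, arXiv:1811.00502, §1 ("no known … monotonicity formulae"). [AlbrittonBarker2019]
-/

noncomputable section

open Set Function Topology

namespace Summit.NavierStokesRegularity.NavierStokesRegularity.Theorems.SymmetricScarExists.Negative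

section SelectionSkeleton

/-- **The abstract one-slice selection principle** (shape of the route's foreseen `OneSliceSelection`):
every non-empty compact Hausdorff space with a continuous `ℝ`-flow `φ` and a commuting continuous
`ℝ/ℤ`-action `ρ` (an `ℝ`-action with `ρ 1 = id`) has a point fixed by `φ` or fixed by `ρ`. -/
def OneSliceSelectionSkeleton : Prop :=
  ∀ (X : Type) [TopologicalSpace X] [CompactSpace X] [T2Space X] [Nonempty X]
    (φ ρ : ℝ → X → X),
    Continuous (uncurry φ) → Continuous (uncurry ρ) →
    (∀ x, φ 0 x = x) → (∀ s t x, φ (s + t) x = φ s (φ t x)) →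
    (∀ x, ρ 0 x = x) → (∀ s t x, ρ (s + t) x = ρ s (ρ t x)) → (∀ x, ρ 1 x = x) →
    (∀ s θ x, φ s (ρ θ x) = ρ θ (φ s x)) →
    ∃ x, (∀ s, φ s x = x) ∨ (∀ θ, ρ θ x = x)

/-- The half-turn of the circle `ℝ/ℤ` is not trivial: `(1/2 : ℝ) ≠ 0` in `AddCircle 1`. [folklore] -/
theorem addCircle_one_half_ne_zero : ((1 / 2 : ℝ) : AddCircle (1 : ℝ)) ≠ 0 := by
  intro h
  rw [AddCircle.coe_eq_zero_iff] at h
  obtain ⟨n, hn⟩ := h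
  rw [zsmul_eq_mul, mul_one] at hn
  have h2 : (2 * n : ℤ) = 1 := by
    have : (2 * n : ℝ) = 1 := by rw [hn]; norm_num
    exact_mod_cast this
  omega

/-- **The selection skeleton is false**: translations on the circle `ℝ/ℤ` form a minimal flow
commuting with the (free) circle action by translations; neither has a fixed point.
[cite: Furstenberg1981, Ch. 1] -/
theorem not_oneSliceSelectionSkeleton : ¬ OneSliceSelectionSkeleton := by
  intro h
  have hcont : Continuous (uncurry fun (s : ℝ) (x : AddCircle (1 : ℝ)) => x + (s : AddCircle (1 : ℝ))) := by
    exact continuous_snd.add (AddCircle.continuous_mk' (1 : ℝ) |>.comp continuous_fst)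
  obtain ⟨x, hx⟩ := h (AddCircle (1 : ℝ)) (fun s x => x + (s : AddCircle (1 : ℝ)))
    (fun s x => x + (s : AddCircle (1 : ℝ))) hcont hcont
    (fun x => by simp) (fun s t x => by rw [AddCircle.coe_add]; abel)
    (fun x => by simp) (fun s t x => by rw [AddCircle.coe_add]; abel)
    (fun x => by
      show x + ((1 : ℝ) : AddCircle (1 : ℝ)) = x
      rw [AddCircle.coe_period, add_zero])
    (fun s θ x => by abel)
  rcases hx with hφ | hρ
  · have := hφ (1 / 2)
    exact addCircle_one_half_ne_zero (by simpa using this)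
  · have := hρ (1 / 2)
    exact addCircle_one_half_ne_zero (by simpa using this)

end SelectionSkeleton

end Summit.NavierStokesRegularity.NavierStokesRegularity.Theorems.SymmetricScarExists.Negative
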